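import Mathlib
import HarnessLib
import HarnessLib.Audit
import Summits.CriticalPhenomena.Statement

/-!
Route: PercAnnulusCrossing

DORMANT since 2026-08-28T23:00:45Z (reconciler: no traction for 5.1 d (last activity statement-closed at 2026-08-23T20:02:25Z); parked, not closed — `ledger route dormant route-CriticalPhenomena-PercAnnulusCrossing --off` to reactivate) — unstaffed, not closed; items shared with open routes are served there. `ledger route dormant <id> --off` reactivates.

It suffices to show X_B [annulus crossing probabilities stay away from 1 at p_c — a 3-D
box-crossing/RSW statement]:
there is c > 0 such that for every n ≥ 1,  P_{p_c}( B(n) ↔ ∂B(2n) inside B(2n) ) ≤ 1 − c,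
i.e. with probability at least c no open path of B(2n) joins the inner box B(n) = [−n,n]³ to the
inner vertex boundary of
B(2n) (dually: a closed plaquette surface of the dual lattice separates B(n) from ∂B(2n)).
Assembly: if θ(p) > 0 then P_p(B(n) ↔ ∂B(2n) in B(2n)) ≥ P_p(B(n) meets an infinite cluster) → 1
(zero-one law, Grimmett1999
Thm (1.11)); at p = p_c this contradicts X_B. So (θ>0 ⇒ crossing → 1) → X_B →
PercolationContinuityZ3.

Lean (X_B): ∃ c : ℝ, 0 < c ∧ ∀ n : ℕ, 1 ≤ n → (Literature.Probability.Percolation.bondPercolation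
(Literature.Probability.LatticeModels.zdGraph 3) (Literature.Probability.Percolation.criticalProbI
3)).real {ω | ∃ x ∈ Literature.Probability.LatticeModels.box 3 n, ∃ y ∈
Literature.Probability.LatticeModels.innerBoundary (Literature.Probability.LatticeModels.zdGraph 3)
(Literature.Probability.LatticeModels.box 3 (2 * n)), ω ∈
Literature.Probability.Percolation.openConnIn ↑(Literature.Probability.LatticeModels.box 3 (2 * n))
x y} ≤ 1 - c

Rationale: WHY THIS LINE. In d = 2, θ(p_c) = 0 (Harris–Kesten; Grimmett1999 §11) is a corollary of the
box-crossing (RSW) property: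
crossing probabilities of fixed-aspect-ratio shapes at p_c are bounded away from 0 AND 1, so closed
dual circuits occur in
every dyadic annulus with probability ≥ c. X_B is the d = 3 analogue of the upper half of RSW, with
dual circuits replaced by
closed plaquette separating surfaces (bond/plaquette duality in ℤ³:
Aizenman–Chayes–Chayes–Fröhlich–Russo 1983, Grimmett1999
§8.9 notes / Kesten1982). It is a genuinely LOW-dimensional thesis: for d > 6 the analogue of X_B is
false although
θ(p_c) = 0 holds (the number of spanning clusters of an annulus grows like n^{d−6}, Aizenman 1997;
crossing probability → 1),
so any proof must use d = 3 < 6, i.e. hyperscaling-type input — this is what distinguishes the route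
from the two
renormalisation routes (PercHalfSpace, PercOpenSupercrit) and from PercTwoPointDecay. Numerics
support X_B: spanning
probabilities of 3-D critical systems converge to universal constants strictly inside (0,1). Areas
imported: planar RSW (Tassion2024, Russo1978), duality with random surfaces (ACCFR 1983),
incipient-spanning-cluster counts (Aizenman 1997, Borgs–Chayes–Kesten–Spencer 1999).
WARNING recorded for refuters/provers: 'small non-crossing probability at ONE scale ⇒ supercritical'
is FALSE (for p ↑ p_c
and n ≈ 5ξ(p) the annulus is crossed with overwhelming probability by one of ≈ n² boundary attempts
although θ(p) = 0), so
X_B cannot be reached by a one-scale finite-size criterion; it must be proved AT p_c, across all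
scales.

RANKED CRUXES. (rev 4, 2026-08-17: BC2 REDIRECT of the restated deciding crux.) X_B =
CritAnnulusNonCrossing (stmt-0846,
 r2) is at least as strong as the conjunct and is now the DERIVED assembly node: X_B ⇐ r3 ∧ r4 by
the LANDED non-trivial theorem
 StubBlockerRSWGlue.critAnnulusNonCrossing_of (p121157; tiling + six-slab Harris + small scales) =
the support item BlockerRSWGlue
 (stmt-1151, one-line close attached). closes (BlockerRSW3D) (CubeBlockingSeed) (BlockerRSWGlue)
(CrossingTendstoOne): the OPEN
 leaves are r3, r4; probes rᵢ → S, rᵢ → X_B fail (Cruxes/CritAnnulusNonCrossing/BC2-REDIRECT.md);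
X_B → r4 landed (p124521).
 r3 BlockerRSW3D (stmt-1129): Benjamini–Kalai plaquette-RSW for closed blockers of ℤ³ at EVERY p —
one monotone f > 0 on (0,∞),
 f(P_p(n-cube sealed)) ≤ P_p([0,n]×[0,2n]² sealed); a comparison (consistent with d > 6, FK q ≥ 1).
Line registered:
 Cruxes/CritAnnulusNonCrossing/Lines/blocker_tilt_allp.lean (p-uniform tilt balancing + diagonal,
glued by the PROVED TiltSquaring).
 r4 CubeBlockingSeed (stmt-1141, shared with PercTiltedBlockers): P_{p_c}(n-cube sealed) ≥ c > 0 ∀n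
— the d = 3, q = 1
 hyperscaling seed. Line registered: Cruxes/CubeBlockingSeed/Lines/birth.lean.
 support: CrossingTendstoOne (PROVED); BlockerRSWGlue (PROVED in tree, close pending);
CritCrossingPolyDecay (≡ X_B); SurfaceRSW3D
(f = id, not load-bearing). Assembly (PROVED): CrossingTendstoOne → X_B → PercolationContinuityZ3.

KILL CRITERIA. X_B is strictly stronger than the conjunct; P_{p_c}(B(n) ↔ ∂B(2n)) → 1 in d = 3
closes the route without touching
θ(p_c) = 0, and (landed X_B → r4) so does P_{p_c}(n-cube crossed) → 1 on a subsequence (¬r4). A d ≥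
7 counterexample to the analogue
of X_B is EXPECTED and harmless: r4 must be d-specific, r3 (a comparison) need not be. ¬r3 kills
this route, not PercTiltedBlockers.

NOT DECOMPOSED YET. Below r3: the p-uniform common-level balancing (stub_balancingAllP, the 3-D
replacement of Tassion's landing
pigeonhole) and the short-box part of stub_diagonalAllP; below r4: stub_tallSeed, stub_halvingRung.
No plaquette/surface notion
is needed any more (open-path connectivity in boxes only).

CHEAPEST FALSIFIER. MC at p_c = 0.2488 of P(n-cube sealed), n = 8…128: a decreasing trend sinks r4
and X_B (current data on
stmt-0846/1141: 0.31 → 0.675 for n ≤ 32, not decreasing); for r3, scan P_p(wide sealed) against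
P_p(cube sealed) over p near p_c,
n ≤ 32, for the necessary witness shape f(s) = O(s^{4−ε}) (refuter crux-attack, stmt-1129).

Novelty: NOVELTY (retriage planner, 2026-08-14; searched BEFORE claiming: `lit search --hybrid`/`lit vsearch`
("Russo-Seymour-Welsh three dimensions crossing probability bounded away from one"; "RSW-type
theorem for closed plaquette surfaces in Z^3"), `lit search --source all` ("crossing probabilities
critical percolation three dimensions", "Russo-Seymour-Welsh higher dimensions"; OpenAlex/S2/arXiv
rate-limited, crossref/zbMATH + local store used), `lit frontier CriticalPhenomena --since 2020`,
`lit galaxy search --star pdf` ("Russo-Seymour-Welsh", "spanning probability in 3D percolation",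
"crossing probabilities three-dimensional percolation"), `lit read` arXiv:1512.09107 p.7,
arXiv:cond-mat/9609240 pp.1,6, arXiv:1512.05178 pp.1-2, arXiv:2011.04618 pp.1-2, arXiv:1302.0421
p.5).
Nearest prior art FOUND: (i) NewmanTassionWu2017 (arXiv:1512.09107) Thm 3.1 + Cor 3.2(2): the
verbatim X_B — 'P[exists open path from B_n to dB_2n] <= 1-c', read as blocking closed plaquette
surfaces (Remark 1) — at p_c of every SLAB S_k = Z^2 x {0..k}; constants c(k) -> 0 and "Z^3 (which
corresponds to k = infinity)" left open (Remark p.7); independently Basu-Sapozhnikov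
arXiv:1512.05178 (lower bounds, slabs). (ii) d = 2: RSW/box-crossing => theta(p_c) = 0 (Grimmett1999
§11.7 (11.70); in tree as the fact Literature.Probability.Percolation.rsw_half);
Kohler-Schindler-Tassion arXiv:2011.04618: RSW from symmetry + positive association alone, but for
PLANAR processes only. (iii) d > 6: the analogue of X_B is FALS  [refs: 1512.09107, cond-mat/9609240, 1512.05178, 2011.04618, 1302.0421, NewmanTassionWu2017, Grimmett1999, Aizenman1997, BorgsChayesKestenSpencer1999, DuminilCopinICM2018]

Barriers (technique_class: RSW box-crossing plaquette-surface duality FKG d-specific): BARRIERS (catalogue Literature/Barriers/CriticalPhenomena, percolation entries read 2026-08-14;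
technique_class: RSW box-crossing plaquette-surface duality FKG d-specific).
Literature.Barriers.CriticalPhenomena.SpanningClustersAboveSix: APPLIES to the letter — X_B is
exactly the RSW-type input 'P_{p_c}(box/annulus spanned) <= 1-c uniformly in the size' that is false
for d > 6 under eta = 0 (SpanningClustersAboveSix.not_bounded_away_from_one; bulk b.c. there, our
free-b.c. annulus is covered by Aizenman's prose only). Evasion as designed: the route is declared
dimension-specific — the surface-RSW step and the seed must use d = 3 < 6 (hyperscaling side,
BorgsChayesKestenSpencer1999); a d-uniform proof attempt is a kill criterion. Honest part: no
concrete d = 3-only ingredient is identified yet; the bet is that plaquette-surface duality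
(specific to d = 3: dual of a bond is a 2-cell) is that ingredient.
Literature.Barriers.CriticalPhenomena.TransverseCrossingsNeedNotMeet: APPLIES to any verbatim
transfer of planar path gluing. Evaded in form: the route glues closed plaquette SURFACES
(codimension 1); a surface separating top from bottom of a box meets every top-bottom path (duality,
Grimmett1999 §12.4) and every transverse separating surface, so the 'three pieces block the longer
box' combinatorics of RSW survives with FKG for the decreasing surface events. NOT evaded in
substance: the planar proofs of the RSW comparison itself (lowest crossing + reflection;
Kohler-Schindler-Tas

History (route lifecycle, newest last):
- 2026-08-28T23:00:45Z · DORMANT — reconciler: no traction for 5.1 d (last activity statement-closed at 2026-08-23T20:02:25Z); parked, not closed — `ledger route dormant route-CriticalPhenomena-P (operator:999:1891539)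

sub-problem: PercolationContinuityZ3 · status: dormant · opened planner-plan-CriticalPhenomena-PercolationContinuityZ3-0 2026-08-13T19:15:45Z · rev 5 · ledger route-CriticalPhenomena-PercAnnulusCrossing
GENERATED by the gate from the ledger (D-0016/17). Provers cite these decls: `theorem foo : Summit.CriticalPhenomena.PercolationContinuityZ3.Theses.PercAnnulusCrossing.<Decl> := …` in Summits/CriticalPhenomena/PercolationContinuityZ3/Theorems/<Name>.lean.
-/

namespace Summit.CriticalPhenomena.PercolationContinuityZ3.Theses.PercAnnulusCrossing

open scoped BigOperators Topology Manifold Classical MeasureTheory ProbabilityTheory Matrix InnerProductSpace ComplexConjugate ContinuousMap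
open Filter Set Function TopologicalSpace MeasureTheory

attribute [summit_statement] _root_.PercolationContinuityZ3

/-- item stmt-CriticalPhenomena-1129 · crux · rank 3 · open · by planner
why it might fail: Open problem (BenjaminiKalai2018 p.71, verbatim). All RSW proofs use planarity: Tassion's landing-point pigeonhole+gluing (arXiv:1410.6773 L2.1-2.2) has no cutset analogue - a blocker's trace on a face is a curve; banded traces neither cover {blocked} nor glue (refuter triage-6-0).
sources: BenjaminiKalai2018 p.71 (doi:10.2140/memocs.2018.6.69, read p0004): 'RSW for plaquettes in cubes: if P(no open top-bottom path in n x n x n) >= 1/2 then none in 2n x 2n x n w.p. bounded away from 0' = this statement; 'well-known, very important open problem', arXiv:1410.6773 (Tassion 2016) sec.2 Lemmas 2.1-2.2, 3.1: symmetry+FKG RSW in the plane - the proof to transfer; breaks at the landing datum for cutsets, arXiv:2011.04618 (Koehler-Schindler-Tassion): RSW for symmetric positively associated measures, PLANAR only, DuminilCopinSidoraviciusTassion2016 (arXiv:1401.7130) sec.1: in d=3 transverse crossings need not meet; Literature.Barriers.CriticalPhenomena.TransverseCrossingsNeedNotMeet, idea card CriticalPhenomena/PercolationContinuityZ3/blockers-glue-tassion-on-cutsets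 (new-combination): Union Lemma for cutsets is dimension-free; refuter triage-6-0 records the exact failing transfer step, NewmanTassionWu2017 (arXiv:1512.09107) Thm 3.1: RSW on slabs S_k only, constants c(k) -> 0
[crux] r3 BlockerRSW3D = the HARD direction of SurfaceRSW3D (route-repair 2026-08-15; SurfaceRSW3D
stmt-0869 is typed in the trivial direction f = id and should be dropped by tenure/operator): a
Russo-Seymour-Welsh inequality for closed BLOCKERS (edge cutsets) in Z^3, valid at every p in [0,1]
and n >= 1: f(P_p(no open path inside the cube [0,n]^3 from the face x_0=0 to the face x_0=n)) <=
P_p(no open path inside the wide box [0,n]x[0,2n]x[0,2n] from x_0=0 to x_0=n), for one increasing f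
independent of p,n with f>0 on (0,oo). Verbatim the Benjamini-Kalai 2018 open problem 'RSW for
plaquettes in cubes' (p.71). Non-trivial: {wide box blocked} is contained in {cube blocked}, so f=id
would force equality. Blockers glue for free in any dimension (Union Lemma, card
blockers-glue-tassion-on-cutsets), so no plaquette/surface notion is needed; the open part is the
shape comparison itself (Tassion/KST use planarity through the ORDER of landing points). Equivalent
qualitative form: for every s>0, inf{P_p(wide blocked) : P_p(cube blocked) >= s} > 0. Why it might
fail: Open problem (BenjaminiKalai2018 p.71, verbatim). All RSW proofs use planarity: Tassion's
landing-point pigeonhole+gluing (arXi -/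
@[route_item "route-CriticalPhenomena-PercAnnulusCrossing"]
def BlockerRSW3D : Prop :=
  ∃ f : ℝ → ℝ, Monotone f ∧ (∀ s, 0 < s → 0 < f s) ∧ ∀ (p : unitInterval) (n : ℕ), 1 ≤ n → f ((Literature.Probability.Percolation.bondPercolation (Literature.Probability.LatticeModels.zdGraph 3) p).real {ω | ¬ ∃ x ∈ Finset.Icc (0 : Literature.Probability.LatticeModels.Site 3) ![(n : ℤ), n, n], ∃ y ∈ Finset.Icc (0 : Literature.Probability.LatticeModels.Site 3) ![(n : ℤ), n, n], x 0 = 0 ∧ y 0 = n ∧ ω ∈ Literature.Probability.Percolation.openConnIn ↑(Finset.Icc (0 : Literature.Probability.LatticeModels.Site 3) ![(n : ℤ), n, n]) x y}) ≤ (Literature.Probability.Percolation.bondPercolation (Literature.Probability.LatticeModels.zdGraph 3) p).real {ω | ¬ ∃ x ∈ Finset.Icc (0 : Literature.Probability.LatticeModels.Site 3) ![(n : ℤ), 2 * n, 2 * n], ∃ y ∈ Finset.Icc (0 : Literature.Probability.LatticeModels.Site 3) ![(n : ℤ), 2 * n, 2 * n], x 0 = 0 ∧ y 0 = n ∧ ω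 ∈ Literature.Probability.Percolation.openConnIn ↑(Finset.Icc (0 : Literature.Probability.LatticeModels.Site 3) ![(n : ℤ), 2 * n, 2 * n]) x y}

/-- item stmt-CriticalPhenomena-1141 · crux · rank 4 · open · by planner
why it might fail: False iff P_{p_c}(n-cube crossed face-to-face) -> 1 on a subsequence: the proliferating-spanning-cluster picture PROVED for d>6 under eta=0 (Aizenman1997 Thm 4; barrier SpanningClustersAboveSix). No self-duality pins it in d=3; support is numerical only (R_c in (0,1), arXiv:1302.0421).
sources: BorgsChayesKestenSpencer1999: hyperscaling postulates = critical crossing probabilities of fixed shapes bounded away from 0 AND 1 (expected exactly for d <= 6), Aizenman1997 Thm 4 (arXiv:cond-mat/9609240 p.6): d>6, eta=0 => crossing probability -> 1 (about n^{d-6} spanning clusters), Literature.Barriers.CriticalPhenomena.SpanningClustersAboveSix (not_bounded_away_from_one): the seed is false above six dimensions - any proof must use d=3, Literature.Barriers.CriticalPhenomena.RandomClusterFirstOrder: the seed cannot hold q-uniformly (wired critical RCM percolates for large q on Z^3) - input must be q=1-specific, arXiv:1302.0421 p.5 (Wang-Zhou-Zhang-Garoni-Deng 2013): wrapping probability R_c^(x)=0.25780(6)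 at p_c(Z^3), numerical only, BenjaminiKalai2018 p.71: the hypothesis 'P(no top-bottom open path in the n-cube) >= 1/2' of the plaquette-RSW problem
[crux] r4, the seed at criticality (q=1-, d<6-specific hyperscaling input): there is c>0 with
P_{p_c}(no open path inside [0,n]^3 from the face x_0=0 to the face x_0=n) >= c for all n >= 1, i.e.
the critical cube-crossing probability stays away from 1. With r3 = BlockerRSW3D (all shapes from
one shape) and BlockerRSWGlue this yields X_B = CritAnnulusNonCrossing. In d=2 the seed is free
(self-duality, P = 1/2); in d=3 it is the hyperscaling postulate of Borgs-Chayes-Kesten-Spencer 1999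
and is FALSE for d>6 (Aizenman 1997). The complementary lower bound P_{p_c}(cube crossed) >= c' is
standard (finite-size criterion for exponential decay + criticality) and is NOT this item. Why it
might fail: False iff P_{p_c}(n-cube crossed face-to-face) -> 1 on a subsequence: the
proliferating-spanning-cluster picture PROVED for d>6 under eta=0 (Aizenman1997 Thm 4; barrier
SpanningClustersAboveSix). No self-duality pins it in d=3; support is numerical only (R_c in (0,1),
arXiv:1302.0421). Sources: BorgsChayesKestenSpencer1999: hyperscaling postulates = critical crossing
probabilities of fixed shapes bounded away from 0 AND 1 (expected exactly for d <= 6); Aizenman1997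
Thm 4 (arXiv:cond-mat/9609240 p -/
@[route_item "route-CriticalPhenomena-PercAnnulusCrossing"]
def CubeBlockingSeed : Prop :=
  ∃ c : ℝ, 0 < c ∧ ∀ n : ℕ, 1 ≤ n → c ≤ (Literature.Probability.Percolation.bondPercolation (Literature.Probability.LatticeModels.zdGraph 3) (Literature.Probability.Percolation.criticalProbI 3)).real {ω | ¬ ∃ x ∈ Finset.Icc (0 : Literature.Probability.LatticeModels.Site 3) ![(n : ℤ), n, n], ∃ y ∈ Finset.Icc (0 : Literature.Probability.LatticeModels.Site 3) ![(n : ℤ), n, n], x 0 = 0 ∧ y 0 = n ∧ ω ∈ Literature.Probability.Percolation.openConnIn ↑(Finset.Icc (0 : Literature.Probability.LatticeModels.Site 3) ![(n : ℤ), n, n]) x y}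

/-- item stmt-CriticalPhenomena-0846 · aside · rank 2 · open · by planner
why it might fail: False iff limsup_n P_{p_c}(B(n)↔∂B(2n) in B(2n)) = 1, i.e. critical spanning clusters proliferate and blocking closed surfaces get rare — the PROVED picture for d>6 under η=0 (Aizenman1997 Thm 4). In d=3 only numerics (R_c≈0.258, β/ν≈0.477) and slab analogues with c(k)→0 (NTW2017) support it.
sources: NewmanTassionWu2017 Thm 3.1, Cor 3.2(2) and Remark p.7 (arXiv:1512.09107): verbatim X_B on slabs S_k, constants c(k)→0, Z³ = 'k=∞' open, Aizenman1997 Thm 4 (arXiv:cond-mat/9609240, p.6): d>6, η=0 ⇒ spanning probability → 1, ≈L^{d-6} spanning clusters, Literature.Barriers.CriticalPhenomena.SpanningClustersAboveSix (Literature.Barriers.CriticalPhenomena.SpanningClustersAboveSix.not_bounded_away_from_one), arXiv:1302.0421 p.5 (Wang–Zhou–Zhang–Garoni–Deng 2013): universal wrapping probability R^{(x)}_c = 0.25780(6) ∈ (0,1), β/ν = 0.47705(15) at p_c(Z³) — numerical only, Grimmett1999 §11.7 (11.70) RSW in d=2 (in tree: fact Literature.Probability.Percolation.rsw_half); BorgsChayesKestenSpencer1999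 (uniform critical crossing bounds ⇒ hyperscaling, expected only for d ≤ 6), arXiv:1512.05178 (Basu–Sapozhnikov 2017, AIHP): crossing probabilities on slabs, lower bounds; slabs only
[crux] r2 = X_B: at p = p_c(Z^3), uniformly in n ≥ 1, with probability ≥ c > 0 there is NO open path
inside B(2n) from the box B(n) = box 3 n to the inner vertex boundary of B(2n) (innerBoundary
(zdGraph 3) (box 3 (2n))); equivalently a closed dual plaquette surface separates B(n) from ∂B(2n).
3-D analogue of the RSW upper bound; expected true in d = 3 (universal spanning probabilities in
(0,1)), false in d > 6 (Aizenman 1997 spanning clusters). Sources: Grimmett1999 §11 (d=2 mechanism),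
Tassion2024. -/
@[route_item "route-CriticalPhenomena-PercAnnulusCrossing"]
def CritAnnulusNonCrossing : Prop :=
  ∃ c : ℝ, 0 < c ∧ ∀ n : ℕ, 1 ≤ n → (Literature.Probability.Percolation.bondPercolation (Literature.Probability.LatticeModels.zdGraph 3) (Literature.Probability.Percolation.criticalProbI 3)).real {ω | ∃ x ∈ Literature.Probability.LatticeModels.box 3 n, ∃ y ∈ Literature.Probability.LatticeModels.innerBoundary (Literature.Probability.LatticeModels.zdGraph 3) (Literature.Probability.LatticeModels.box 3 (2 * n)), ω ∈ Literature.Probability.Percolation.openConnIn ↑(Literature.Probability.LatticeModels.box 3 (2 * n)) x y} ≤ 1 - c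

/-- item stmt-CriticalPhenomena-0869 · support · rank 3 · closed · proved by Summit.CriticalPhenomena.PercolationContinuityZ3.Theorems.PercAnnulusCrossingSurfaceRSW3D.surfaceRSW3D_proof @ 3a592c63e608 (prover) · by planner
sources: evidence run/gate/evidence/stmt-CriticalPhenomena-0869/20260813T205548Z-Proof0869.lean (refuter g29-0: f = id, rc0, 0 sorry), NewmanTassionWu2017 Thm 3.1 (arXiv:1512.09107 p.7): nearest print RSW statement, slabs only, Literature.Barriers.CriticalPhenomena.TransverseCrossingsNeedNotMeet
[crux] r3 (informal; no signature until a Literature notion of dual plaquette separating surfaces in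
Z^3 exists): a 3-D Russo–Seymour–Welsh inequality for SURFACES, valid at every p ∈ [0,1]: the
probability that a closed dual-plaquette surface inside the box [0,2n]×[0,n]×[0,n] separates its two
square end faces is bounded below by an explicit increasing function f (independent of n, p; f(s) >
0 for s > 0) of the probability of the same event in the cube [0,n]^3; combined with FKG gluing of
surfaces this yields closed separating spheres in dyadic annuli, i.e. X_B = CritAnnulusNonCrossing,
from a seed lower bound at p_c. Template: planar RSW (Russo1978; Grimmett1999 §11.7; Tassion2024);
duality bond/plaquette in Z^3 (Aizenman–Chayes–Chayes–Fröhlich–Russo 1983, Grimmett1999 §8.9 notes).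
Refuters: shape-comparison for surfaces may fail without a lower bound on surface "thickness";
provers: any f works. -/
@[route_item "route-CriticalPhenomena-PercAnnulusCrossing"]
def SurfaceRSW3D : Prop :=
  ∃ f : ℝ → ℝ, Monotone f ∧ (∀ s, 0 < s → 0 < f s) ∧ ∀ (p : unitInterval) (n : ℕ), 1 ≤ n → f ((Literature.Probability.Percolation.bondPercolation (Literature.Probability.LatticeModels.zdGraph 3) p).real {ω | ¬ ∃ x ∈ Finset.Icc (0 : Literature.Probability.LatticeModels.Site 3) ![(n : ℤ), n, n], ∃ y ∈ Finset.Icc (0 : Literature.Probability.LatticeModels.Site 3) ![(n : ℤ), n, n], x 0 = 0 ∧ y 0 = n ∧ ω ∈ Literature.Probability.Percolation.openConnIn ↑(Finset.Icc (0 : Literature.Probability.LatticeModels.Site 3) ![(n : ℤ), n, n]) x y}) ≤ (Literature.Probability.Percolation.bondPercolation (Literature.Probability.LatticeModels.zdGraph 3) p).real {ω | ¬ ∃ x ∈ Finset.Icc (0 : Literature.Probability.LatticeModels.Site 3) ![2 * (n : ℤ), n, n], ∃ y ∈ Finset.Icc (0 : Literature.Probability.LatticeModels.Site 3) ![2 *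 (n : ℤ), n, n], x 0 = 0 ∧ y 0 = 2 * n ∧ ω ∈ Literature.Probability.Percolation.openConnIn ↑(Finset.Icc (0 : Literature.Probability.LatticeModels.Site 3) ![2 * (n : ℤ), n, n]) x y}

-- `SurfaceRSW3D` holds: proved by `Summit.CriticalPhenomena.PercolationContinuityZ3.Theorems.PercAnnulusCrossingSurfaceRSW3D.surfaceRSW3D_proof` @ 3a592c63e608 (its module imports this route file, so no `_holds` link can be stated here).

/-- item stmt-CriticalPhenomena-0848 · support · rank 9 · closed · proved by Summit.CriticalPhenomena.PercolationContinuityZ3.Theorems.crossingTendstoOne_proof (prover) · by planner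
sources: Grimmett1999 §1.4 Thm (1.11) (PDF p.27/p.32; vendored fact Literature.Probability.Percolation.Grimmett1999_prob_exists_percolatesAt, p3938)
[support] If θ(p) > 0 on Z^3 then P_p(∃ x ∈ B(n), ∃ y ∈ ∂^{in}B(2n), x ↔ y inside B(2n)) → 1 as n →
∞. Proof: {some x ∈ B(n) has |C(x)| = ∞} increases to {∃ infinite cluster}, which has probability 1
when θ(p) > 0 (zero-one law, Grimmett1999 Thm (1.11), p.32); and an infinite open path from x ∈ B(n)
reaches innerBoundary(B(2n)) before leaving B(2n). Needs measurability of the events (Literature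
measurableSet_openConn-type facts). -/
@[route_item "route-CriticalPhenomena-PercAnnulusCrossing"]
def CrossingTendstoOne : Prop :=
  ∀ p : unitInterval, 0 < Literature.Probability.Percolation.theta (Literature.Probability.LatticeModels.zdGraph 3) 0 p → Filter.Tendsto (fun n : ℕ => (Literature.Probability.Percolation.bondPercolation (Literature.Probability.LatticeModels.zdGraph 3) p).real {ω | ∃ x ∈ Literature.Probability.LatticeModels.box 3 n, ∃ y ∈ Literature.Probability.LatticeModels.innerBoundary (Literature.Probability.LatticeModels.zdGraph 3) (Literature.Probability.LatticeModels.box 3 (2 * n)), ω ∈ Literature.Probability.Percolation.openConnIn ↑(Literature.Probability.LatticeModels.box 3 (2 * n)) x y}) Filter.atTop (nhds 1)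

-- `CrossingTendstoOne` holds: proved by `Summit.CriticalPhenomena.PercolationContinuityZ3.Theorems.crossingTendstoOne_proof` (its module imports this route file, so no `_holds` link can be stated here).

/-- item stmt-CriticalPhenomena-0849 · support · rank 9 · open · by planner
sources: NewmanTassionWu2017 Cor 3.2(3) and §3.8 (arXiv:1512.09107): slab analogue, dyadic-annulus independence argument
[support] Exponent form of X_B: ∃ a>0, C: for 1 ≤ n ≤ m, P_{p_c}(B(n) ↔ ∂^{in}B(m) inside B(m)) ≤ C
(n/m)^a. From X_B: the events {B(2^k n) ↔ ∂B(2^{k+1} n) in B(2^{k+1}n)} use disjoint edge sets,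
hence are independent, and B(n) ↔ ∂B(m) in B(m) implies all of them for 2^{k+1} n ≤ m; so the
probability is ≤ (1−c)^{⌊log₂(m/n)⌋}. Conversely it yields X_B with aspect ratio 2 replaced by a
large λ (and the Assembly works for any fixed aspect ratio). Numerically a is at most the one-arm
exponent β/ν ≈ 0.48. -/
@[route_item "route-CriticalPhenomena-PercAnnulusCrossing"]
def CritCrossingPolyDecay : Prop :=
  ∃ a C : ℝ, 0 < a ∧ ∀ n m : ℕ, 1 ≤ n → n ≤ m → (Literature.Probability.Percolation.bondPercolation (Literature.Probability.LatticeModels.zdGraph 3) (Literature.Probability.Percolation.criticalProbI 3)).real {ω | ∃ x ∈ Literature.Probability.LatticeModels.box 3 n, ∃ y ∈ Literature.Probability.LatticeModels.innerBoundary (Literature.Probability.LatticeModels.zdGraph 3) (Literature.Probability.LatticeModels.box 3 m), ω ∈ Literature.Probability.Percolation.openConnIn ↑(Literature.Probability.LatticeModels.box 3 m) x y} ≤ C * ((n : ℝ) / m) ^ a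

/-- item stmt-CriticalPhenomena-1151 · support · rank 9 · closed · proved by Summit.CriticalPhenomena.PercolationContinuityZ3.Theorems.PercAnnulusCrossingBlockerRSWGlue.blockerRSWGlue_proof @ 4392299d034b (prover) · by planner
sources: idea card CriticalPhenomena/PercolationContinuityZ3/blockers-glue-tassion-on-cutsets (Union Lemma, six-wall shell), Grimmett1999 sec.11.7 (annulus from translated rectangles; FKG), Literature.Probability.Percolation.harris_fkg_holds (InequalitiesProofs.lean), BondPercolationSymmetry.lean (proved tools)
[support] BlockerRSW3D -> CubeBlockingSeed -> CritAnnulusNonCrossing (spelled out). Proof, routine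
over PROVED library facts: at p=p_c the seed gives P(cube blocked) >= c0 and r3 gives b2 :=
P([0,n]x[0,2n]^2 blocked in the n-direction) >= f(c0) > 0. Union Lemma (deterministic): boxes A,B
overlapping in a box O with the full cross-section, E_A,E_B closed cutsets blocking A,B in direction
x, W a cutset separating the two faces of O transverse to the extension direction => E_A u E_B u W
blocks A u B in direction x (a crossing avoiding W cannot visit both A-O and B-O). Restriction: a
blocker of a box blocks every full-cross-section sub-box; a transverse blocker of O is implied by a
blocker of a wide box containing O with the same transverse extent. Harris-FKG for the decreasing
blocking events (Literature.Probability.Percolation.harris_fkg_holds / infinitePi_harris_lower) and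
lattice symmetries (BondPercolationSymmetry.lean: bondPercolation_real_preimage_relabel_iso, shifts;
coordinate permutations and reflections are automorphisms of zdGraph 3) give P([0,n]x[0,3n]x[0,2n]
blocked) >= b2^3, P([0,n]x[0,4n]x[0,2n]) >= b2^5, P([0,n]x[0,4n]^2) >= b2^25. Annulus: an open path
inside B(2n) fr -/
@[route_item "route-CriticalPhenomena-PercAnnulusCrossing"]
def BlockerRSWGlue : Prop :=
  (∃ f : ℝ → ℝ, Monotone f ∧ (∀ s, 0 < s → 0 < f s) ∧ ∀ (p : unitInterval) (n : ℕ), 1 ≤ n → f ((Literature.Probability.Percolation.bondPercolation (Literature.Probability.LatticeModels.zdGraph 3) p).real {ω | ¬ ∃ x ∈ Finset.Icc (0 : Literature.Probability.LatticeModels.Site 3) ![(n : ℤ), n, n], ∃ y ∈ Finset.Icc (0 : Literature.Probability.LatticeModels.Site 3) ![(n : ℤ), n, n], x 0 = 0 ∧ y 0 = n ∧ ω ∈ Literature.Probability.Percolation.openConnIn ↑(Finset.Icc (0 : Literature.Probability.LatticeModels.Site 3) ![(n : ℤ), n, n]) x y}) ≤ (Literature.Probability.Percolation.bondPercolation (Literature.Probability.LatticeModels.zdGraph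 3) p).real {ω | ¬ ∃ x ∈ Finset.Icc (0 : Literature.Probability.LatticeModels.Site 3) ![(n : ℤ), 2 * n, 2 * n], ∃ y ∈ Finset.Icc (0 : Literature.Probability.LatticeModels.Site 3) ![(n : ℤ), 2 * n, 2 * n], x 0 = 0 ∧ y 0 = n ∧ ω ∈ Literature.Probability.Percolation.openConnIn ↑(Finset.Icc (0 : Literature.Probability.LatticeModels.Site 3) ![(n : ℤ), 2 * n, 2 * n]) x y}) → (∃ c : ℝ, 0 < c ∧ ∀ n : ℕ, 1 ≤ n → c ≤ (Literature.Probability.Percolation.bondPercolation (Literature.Probability.LatticeModels.zdGraph 3) (Literature.Probability.Percolation.criticalProbI 3)).real {ω | ¬ ∃ x ∈ Finset.Icc (0 : Literature.Probability.LatticeModels.Site 3) ![(n : ℤ), n, n], ∃ y ∈ Finset.Icc (0 : Literature.Probability.LatticeModels.Site 3) ![(n : ℤ), n, n], x 0 = 0 ∧ y 0 = n ∧ ω ∈ Literature.Probability.Percolation.openConnIn ↑(Finset.Icc (0 : Literature.Probability.LatticeModels.Site 3) ![(n : ℤ), n, n]) x y}) → ∃ c : ℝ, 0 < c ∧ ∀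 n : ℕ, 1 ≤ n → (Literature.Probability.Percolation.bondPercolation (Literature.Probability.LatticeModels.zdGraph 3) (Literature.Probability.Percolation.criticalProbI 3)).real {ω | ∃ x ∈ Literature.Probability.LatticeModels.box 3 n, ∃ y ∈ Literature.Probability.LatticeModels.innerBoundary (Literature.Probability.LatticeModels.zdGraph 3) (Literature.Probability.LatticeModels.box 3 (2 * n)), ω ∈ Literature.Probability.Percolation.openConnIn ↑(Literature.Probability.LatticeModels.box 3 (2 * n)) x y} ≤ 1 - c

-- `BlockerRSWGlue` holds: proved by `Summit.CriticalPhenomena.PercolationContinuityZ3.Theorems.PercAnnulusCrossingBlockerRSWGlue.blockerRSWGlue_proof` @ 4392299d034b (its module imports this route file, so no `_holds` link can be stated here).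

/-- item stmt-CriticalPhenomena-0847 · assembly · rank 1 · closed · proved by Summit.CriticalPhenomena.PercolationContinuityZ3.Theorems.percTiltedBlockers_annulusAssembly_proof @ e2daa924ea28 (prover) · by planner
[assembly] CrossingTendstoOne → X_B → PercolationContinuityZ3. Proof: if θ(p_c) ≠ 0 then θ(p_c) > 0,
so by the first hypothesis the crossing probabilities at criticalProbI 3 tend to 1, contradicting
the uniform bound ≤ 1 − c < 1 of X_B (take n large in Filter.Tendsto … (nhds 1)). -/
@[route_item "route-CriticalPhenomena-PercAnnulusCrossing"]
def Assembly : Prop :=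
  (∀ p : unitInterval, 0 < Literature.Probability.Percolation.theta (Literature.Probability.LatticeModels.zdGraph 3) 0 p → Filter.Tendsto (fun n : ℕ => (Literature.Probability.Percolation.bondPercolation (Literature.Probability.LatticeModels.zdGraph 3) p).real {ω | ∃ x ∈ Literature.Probability.LatticeModels.box 3 n, ∃ y ∈ Literature.Probability.LatticeModels.innerBoundary (Literature.Probability.LatticeModels.zdGraph 3) (Literature.Probability.LatticeModels.box 3 (2 * n)), ω ∈ Literature.Probability.Percolation.openConnIn ↑(Literature.Probability.LatticeModels.box 3 (2 * n)) x y}) Filter.atTop (nhds 1)) → (∃ c : ℝ, 0 < c ∧ ∀ n : ℕ, 1 ≤ n → (Literature.Probability.Percolation.bondPercolation (Literature.Probability.LatticeModels.zdGraph 3) (Literature.Probability.Percolation.criticalProbI 3)).real {ω | ∃ x ∈ Literature.Probability.LatticeModels.box 3 n, ∃ y ∈ Literature.Probability.LatticeModels.innerBoundary (Literature.Probability.LatticeModels.zdGraph 3) (Literature.Probability.LatticeModels.box 3 (2 * n)), ω ∈ Literature.Probability.Percolation.openConnIn ↑(Literature.Probability.LatticeModels.box 3 (2 * n)) x y} ≤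 1 - c) → PercolationContinuityZ3

-- `Assembly` holds: proved by `Summit.CriticalPhenomena.PercolationContinuityZ3.Theorems.percTiltedBlockers_annulusAssembly_proof` @ e2daa924ea28 (its module imports this route file, so no `_holds` link can be stated here).

/-! D-0027 §2.1 — DECIDING THEOREM (planner-authored via `route open/edit --closes-file`; by planner-cstrat-stmt-CriticalPhenomena-0846-r1-0 2026-08-17T04:51:26Z):
its hypotheses are this route's items and its conclusion the sub-problem Statement (glue_lint), and it elaborates with this file. -/

@[closes "route-CriticalPhenomena-PercAnnulusCrossing"] theorem closes (h₁ : BlockerRSW3D) (h₂ : CubeBlockingSeed) (h₃ : BlockerRSWGlue) (h₅ : CrossingTendstoOne) :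
    _root_.PercolationContinuityZ3 := by
  -- BC2 REDIRECT (cstrat-stmt-CriticalPhenomena-0846-r1, 2026-08-17). The former deciding crux
  -- X_B = `CritAnnulusNonCrossing` (stmt-0846, at least as strong as the Statement) is now DERIVED:
  -- X_B := h₃ h₁ h₂, where `BlockerRSWGlue` (stmt-1151) is, by decl bodies, exactly
  -- `BlockerRSW3D → CubeBlockingSeed → CritAnnulusNonCrossing` and is PROVED verbatim in the tree
  -- (`Theorems.SubpolynomialBlocking.stub_blockerRSWGlue`, p121157 — a Theorems module importing this
  -- file, hence a hypothesis here rather than an import). The load-bearing OPEN leaves are the two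
  -- pieces `BlockerRSW3D` (stmt-1129, Benjamini–Kalai plaquette-RSW, every p) and `CubeBlockingSeed`
  -- (stmt-1141, the d = 3 hyperscaling seed); `CrossingTendstoOne` is PROVED (crossingTendstoOne_proof).
  -- Then the rev-3 argument: θ(p_c) > 0 ⇒ P_{p_c}(Λ_n ↔ ∂Λ_{2n} in Λ_{2n}) → 1, contradicting ≤ 1 - c.
  have hX : CritAnnulusNonCrossing := h₃ h₁ h₂
  refine Literature.Probability.Percolation.percolationContinuityZ3_iff.2
    (le_antisymm (not_lt.1 fun hθ => ?_) MeasureTheory.measureReal_nonneg)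
  obtain ⟨c, hc, hb⟩ := hX
  obtain ⟨N, hN⟩ :=
    Filter.eventually_atTop.1 ((h₅ _ hθ).eventually_const_lt (sub_lt_self (1 : ℝ) hc))
  exact absurd (hb (max N 1) (le_max_right N 1)) (not_le.2 (hN (max N 1) (le_max_left N 1)))

end Summit.CriticalPhenomena.PercolationContinuityZ3.Theses.PercAnnulusCrossing
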